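/-
Copyright (c) 2026. All rights reserved.
Released under Apache 2.0 license as described in the file LICENSE.
Authors: abc-iut cell, seat abc-iut-L4-t14 (gen 4; proof-only: the centraliser in `PGL₂(ℝ) = Isom(ℍ)` of a
non-abelian subgroup of `PSL₂(ℝ)` acting freely on `ℍ` is trivial — the orientation-blind input
`C_{N_{PGL₂(ℝ)}(Γ̄)}(Γ̄) = 1` of the RC (print-faithful) geometric column of [AbsTopIII] Prop 4.2 (i)).
-/
import Literature.AnabelianGeometry.AbsoluteAnabelian.ArchimedeanHolFieldFunctorGeometricPSLCentralizer
import Mathlib.LinearAlgebra.Matrix.GeneralLinearGroup.Projective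
import HarnessLib

/-!
# Centralisers of torsion-free non-abelian Fuchsian groups in `PGL₂(ℝ) = Isom(ℍ)` are trivial

S. Mochizuki, *Topics in absolute anabelian geometry III*, Def 4.1 (iii) p. 103 and proof of Prop 4.2 (i)
p. 106 l. 14–19 (kurims `paper:url-5493eb38cbb7`; bib key `MochizukiAbsTopIII2015`): the morphisms of `EA`
are the finite étale morphisms of Aut-holomorphic orbispaces, which for Riemann surfaces are the
RC-HOLOMORPHIC ones (holomorphic or anti-holomorphic, Cor 2.3 (i)); so print's `Loc_R(X)` for
`X = ℍ/Γ̄` lives in the full isometry group `Isom(ℍ) = PGL₂(ℝ)` (H. M. Farkas, I. Kra, *Riemann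
Surfaces*, IV.5.6), Mathlib's `Matrix.ProjGenLinGroup (Fin 2) ℝ = PGL(2, ℝ)` acting on `ℍ` by
`UpperHalfPlane.glAction` (determinant `< 0` acting anti-holomorphically).  The orientation-blind input of
the slimness of `N_{PGL₂(ℝ)}(Γ̄)^` (row «J2», abc-iut-L4-d1's `eq_one_of_forall_commute_toCompletion`
applied with `M := N_{PGL₂(ℝ)}(Γ̄)`) is:

* ★ `HolRS.pgl_centralizer_eq_bot` — **for `Γ̄ ≤ PSL₂(ℝ)` non-abelian and acting freely on `ℍ`, the
  centraliser in `PGL(2, ℝ)` of its image under Mathlib's `ProjectiveSpecialLinearGroup.toPGL` is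
  trivial** (abc-iut-L4-t14's `PSL2R` is definitionally Mathlib's `PSL(2, ℝ)`).  Proof: a `GL`-lift `g`
  of a central `z` satisfies `g γ̃ = u • γ̃ g` with `u = ±1` by determinants
  (`GeneralLinearGroup.smul_eq_of_mk_mul_comm`); `u = -1` forces `tr γ̃ = 0`, an elliptic involution,
  excluded by the free action (`GeneralLinearGroup.not_anticomm_of_free`, over p447262's
  `SpecialLinearGroup.exists_smul_eq_of_trace_eq_zero`); so all lifts commute with the non-scalar `g`,
  hence with each other (p447262's `Matrix.two_mul_comm_of_comm_of_not_scalar`), and `Γ̄` would be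
  abelian.  In particular NO anti-holomorphic isometry of `ℍ` commutes with such a `Γ̄` — the
  group-theoretic reason why some finite étale cover of `ℍ/Γ̄` is CHIRAL;
* `HolRS.pgl_centralizer_subgroupOf_normalizer_eq_bot` — the same inside `N_{PGL₂(ℝ)}(Γ̄)` (the `hZ`
  shape of the finite-extension theorem).

Classical `2 × 2` algebra; MODEL side of [AbsTopIII] §4 only; nothing here bears on [IUTchIII]
Cor. 3.12; model ≠ reconstruction.
-/

set_option autoImplicit false

noncomputable section

open scoped UpperHalfPlane MatrixGroups

namespace Literature.AnabelianGeometry.AbsoluteAnabelian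

open _root_.Matrix.ProjGenLinGroup (mk)

/-! ### Lifts to `GL(2, ℝ)`: commutation up to a scalar, and no anticommutation -/

namespace GeneralLinearGroup

/-- If `mk g₁ = mk g₂` in `PGL(2, ℝ)` then `g₂ = u • g₁` as matrices for a unit `u` with `u * u = 1`
whenever `det g₁ = det g₂`. [cite: FarkasKra1992, IV.5.6] -/
theorem exists_smul_eq_of_mk_eq {g₁ g₂ : GL (Fin 2) ℝ} (h : mk g₁ = mk g₂)
    (hdet : (g₁ : Matrix (Fin 2) (Fin 2) ℝ).det = (g₂ : Matrix (Fin 2) (Fin 2) ℝ).det) :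
    ∃ u : ℝ, u * u = 1 ∧ (g₂ : Matrix (Fin 2) (Fin 2) ℝ) = u • (g₁ : Matrix (Fin 2) (Fin 2) ℝ) := by
  obtain ⟨u, hu⟩ := Matrix.ProjGenLinGroup.mk_eq_mk_iff.mp h
  have hmat : (g₂ : Matrix (Fin 2) (Fin 2) ℝ) = (u : ℝ) • (g₁ : Matrix (Fin 2) (Fin 2) ℝ) := by
    rw [← hu, Matrix.GeneralLinearGroup.coe_mul, Matrix.GeneralLinearGroup.coe_scalar, Matrix.scalar_apply,
      ← Matrix.smul_one_eq_diagonal, Matrix.mul_smul, Matrix.mul_one]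
  refine ⟨u, ?_, hmat⟩
  have hd := congrArg Matrix.det hmat
  rw [Matrix.det_smul, Fintype.card_fin, ← hdet] at hd
  have hne : (g₁ : Matrix (Fin 2) (Fin 2) ℝ).det ≠ 0 := by
    rw [← Matrix.GeneralLinearGroup.val_det_apply]
    exact (Matrix.GeneralLinearGroup.det g₁).ne_zero
  have : (u : ℝ) ^ 2 = 1 := by
    have h1 : (g₁ : Matrix (Fin 2) (Fin 2) ℝ).det * 1 = (g₁ : Matrix (Fin 2) (Fin 2) ℝ).det * (u : ℝ) ^ 2 := by
      rw [mul_one, mul_comm]; exact hd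
    exact (mul_left_cancel₀ hne h1).symm
  nlinarith [this]

/-- **No lift of an element of a freely acting `Γ̄ ≤ PSL₂(ℝ)` anticommutes with an element of
`GL(2, ℝ)`**: `g γ̃ = -(γ̃ g)` forces `tr γ̃ = 0`, a fixed point in `ℍ`
(`SpecialLinearGroup.exists_smul_eq_of_trace_eq_zero`), `γ̃ ↦ 1 ∈ Γ̄`, `γ̃ = ±1` central, `γ̃ g = 0`.
[cite: FarkasKra1992, IV.5.6] -/
theorem not_anticomm_of_free (Γ : Subgroup HolRS.PSL2R) [IsCancelSMul Γ ℍ] (g : GL (Fin 2) ℝ)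
    (γ : SL(2, ℝ)) (hγ : (QuotientGroup.mk γ : HolRS.PSL2R) ∈ Γ) :
    (g : Matrix (Fin 2) (Fin 2) ℝ) * γ ≠ -((γ : Matrix (Fin 2) (Fin 2) ℝ) * g) := by
  intro hanti
  -- `g⁻¹ g = 1 = g g⁻¹` as matrices
  have hl : ((g⁻¹ : GL (Fin 2) ℝ) : Matrix (Fin 2) (Fin 2) ℝ) * (g : Matrix (Fin 2) (Fin 2) ℝ) = 1 := by
    rw [← Matrix.GeneralLinearGroup.coe_mul, inv_mul_cancel, Matrix.GeneralLinearGroup.coe_one]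
  have hr : (g : Matrix (Fin 2) (Fin 2) ℝ) * ((g⁻¹ : GL (Fin 2) ℝ) : Matrix (Fin 2) (Fin 2) ℝ) = 1 := by
    rw [← Matrix.GeneralLinearGroup.coe_mul, mul_inv_cancel, Matrix.GeneralLinearGroup.coe_one]
  -- `tr γ = 0`: `γ = -(g⁻¹ γ g)`
  have htr : γ 0 0 + γ 1 1 = 0 := by
    have hγ' : (γ : Matrix (Fin 2) (Fin 2) ℝ) =
        -(((g⁻¹ : GL (Fin 2) ℝ) : Matrix (Fin 2) (Fin 2) ℝ) * γ * g) := by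
      calc (γ : Matrix (Fin 2) (Fin 2) ℝ)
          = ((g⁻¹ : GL (Fin 2) ℝ) : Matrix (Fin 2) (Fin 2) ℝ) * g * γ := by rw [hl, one_mul]
        _ = ((g⁻¹ : GL (Fin 2) ℝ) : Matrix (Fin 2) (Fin 2) ℝ) * ((g : Matrix (Fin 2) (Fin 2) ℝ) * γ) := by
            rw [mul_assoc]
        _ = -(((g⁻¹ : GL (Fin 2) ℝ) : Matrix (Fin 2) (Fin 2) ℝ) * γ * g) := by
            rw [hanti, mul_neg, mul_assoc]
    have ht := congrArg Matrix.trace hγ'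
    rw [Matrix.trace_neg, Matrix.trace_mul_cycle, hr, one_mul, Matrix.trace_fin_two] at ht
    linarith
  -- fixed point ⇒ `γ ↦ 1 ∈ Γ̄` ⇒ `γ` central ⇒ `γ = ±1`
  obtain ⟨τ, hτ⟩ := SpecialLinearGroup.exists_smul_eq_of_trace_eq_zero γ htr
  have h1 : (⟨QuotientGroup.mk γ, hγ⟩ : Γ) = 1 := by
    apply IsCancelSMul.right_cancel _ _ τ
    rw [one_smul]
    change (QuotientGroup.mk γ : HolRS.PSL2R) • τ = τ
    rw [HolRS.psl_mk_smul, hτ]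
  have hγc : γ ∈ Subgroup.center SL(2, ℝ) := by
    have : (QuotientGroup.mk γ : HolRS.PSL2R) = 1 := congrArg Subtype.val h1
    exact (QuotientGroup.eq_one_iff γ).mp this
  -- `γ = ±1` commutes with `g`: `γ g = -(γ g)`, so `γ g = 0`, but `det (γ g) = det g ≠ 0`
  have hcomm : (g : Matrix (Fin 2) (Fin 2) ℝ) * γ = (γ : Matrix (Fin 2) (Fin 2) ℝ) * g := by
    rcases mem_center_sl_iff.mp hγc with rfl | rfl
    · simp
    · simp [Matrix.SpecialLinearGroup.coe_neg]
  rw [hcomm] at hanti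
  have hM : (γ : Matrix (Fin 2) (Fin 2) ℝ) * g = 0 := by
    ext i j
    have hij := congrFun (congrFun hanti i) j
    rw [Matrix.neg_apply] at hij
    rw [Matrix.zero_apply]
    linarith
  have hdet := congrArg Matrix.det hM
  rw [Matrix.det_mul, Matrix.SpecialLinearGroup.det_coe, one_mul, Matrix.det_zero,
    ← Matrix.GeneralLinearGroup.val_det_apply] at hdet
  exact (Matrix.GeneralLinearGroup.det g).ne_zero hdet

end GeneralLinearGroup

/-! ### The centraliser in `PGL(2, ℝ)` -/

namespace HolRS

/-- ★ **`C_{PGL₂(ℝ)}(Γ̄) = 1` for `Γ̄ ≤ PSL₂(ℝ)` non-abelian and acting freely on `ℍ`**: no isometry of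
`ℍ` — holomorphic OR anti-holomorphic — other than the identity commutes with a torsion-free non-abelian
Fuchsian group.  (`Γ̄` is embedded in `PGL(2, ℝ)` by Mathlib's `ProjectiveSpecialLinearGroup.toPGL`;
abc-iut-L4-t14's `PSL2R` is definitionally `PSL(2, ℝ)`.)  This is the orientation-blind input
«an RC-automorphism of `X = ℍ/Γ̄` inducing an inner automorphism of `π₁(X) = Γ̄` is trivial» of the
id-rigidity of print's `EA` (RC-holomorphic morphisms) over `X`. [cite: MochizukiAbsTopIII2015, Proposition 4.2 (i) proof p.106] -/
theorem pgl_centralizer_eq_bot (Γ : Subgroup PSL2R) [IsCancelSMul Γ ℍ] (hΓ : ∃ x y : Γ, x * y ≠ y * x) :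
    Subgroup.centralizer
      ((Γ.map (Matrix.ProjectiveSpecialLinearGroup.toPGL (n := Fin 2) (R := ℝ)) :
        Subgroup PGL(2, ℝ)) : Set PGL(2, ℝ)) = ⊥ := by
  rw [Subgroup.eq_bot_iff_forall]
  intro z hz
  rw [Subgroup.mem_centralizer_iff] at hz
  by_contra hz1
  induction z using Matrix.ProjGenLinGroup.induction_on with
  | mk g =>
    -- `g` is not scalar (else `mk g = 1`)
    have hns : ¬ ((g : Matrix (Fin 2) (Fin 2) ℝ) 0 1 = 0 ∧ (g : Matrix (Fin 2) (Fin 2) ℝ) 1 0 = 0 ∧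
        (g : Matrix (Fin 2) (Fin 2) ℝ) 0 0 = (g : Matrix (Fin 2) (Fin 2) ℝ) 1 1) := by
      rintro ⟨h01, h10, h00⟩
      apply hz1
      have ha : (g : Matrix (Fin 2) (Fin 2) ℝ) 0 0 ≠ 0 := by
        intro h0
        have hd : (g : Matrix (Fin 2) (Fin 2) ℝ).det = 0 := by
          rw [Matrix.det_fin_two, h01, h10, ← h00, h0]; ring
        rw [← Matrix.GeneralLinearGroup.val_det_apply] at hd
        exact (Matrix.GeneralLinearGroup.det g).ne_zero hd
      have hg : g = Matrix.GeneralLinearGroup.scalar (Fin 2) (Units.mk0 _ ha) := by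
        apply Matrix.GeneralLinearGroup.ext
        intro i j
        rw [Matrix.GeneralLinearGroup.coe_scalar]
        fin_cases i <;> fin_cases j <;> simp [h01, h10, h00]
      rw [hg]
      exact Matrix.ProjGenLinGroup.mk_scalar _
    -- every lift of every element of `Γ̄` commutes with `g`
    have hcomm : ∀ γ : SL(2, ℝ), (QuotientGroup.mk γ : PSL2R) ∈ Γ →
        (g : Matrix (Fin 2) (Fin 2) ℝ) * γ = γ * g := by
      intro γ hγ
      have hmem : Matrix.ProjectiveSpecialLinearGroup.toPGL (QuotientGroup.mk γ : PSL2R) ∈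
          Γ.map (Matrix.ProjectiveSpecialLinearGroup.toPGL (n := Fin 2) (R := ℝ)) :=
        Subgroup.mem_map_of_mem _ hγ
      have hq := hz _ hmem
      rw [Matrix.ProjectiveSpecialLinearGroup.toPGL_mk, ← map_mul, ← map_mul] at hq
      -- `mk (toGL γ * g) = mk (g * toGL γ)`: `g γ = u • γ g` with `u = ±1`
      obtain ⟨u, hu1, hu⟩ := GeneralLinearGroup.exists_smul_eq_of_mk_eq hq (by
        rw [Matrix.GeneralLinearGroup.coe_mul, Matrix.GeneralLinearGroup.coe_mul, Matrix.det_mul,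
          Matrix.det_mul, mul_comm])
      rw [Matrix.GeneralLinearGroup.coe_mul, Matrix.GeneralLinearGroup.coe_mul,
        Matrix.SpecialLinearGroup.coe_GL_coe_matrix] at hu
      have hu' : u = 1 ∨ u = -1 := by
        have : (u - 1) * (u + 1) = 0 := by nlinarith
        rcases mul_eq_zero.1 this with h | h
        · exact Or.inl (by linarith)
        · exact Or.inr (by linarith)
      rcases hu' with rfl | rfl
      · rw [one_smul] at hu
        exact hu
      · exfalso
        rw [neg_one_smul] at hu
        exact GeneralLinearGroup.not_anticomm_of_free Γ g γ hγ hu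
    -- hence `Γ̄` is abelian
    obtain ⟨x, y, hxy⟩ := hΓ
    apply hxy
    obtain ⟨xt, hxt⟩ := QuotientGroup.mk_surjective (x : PSL2R)
    obtain ⟨yt, hyt⟩ := QuotientGroup.mk_surjective (y : PSL2R)
    have hx := hcomm xt (hxt ▸ x.2)
    have hy := hcomm yt (hyt ▸ y.2)
    have hxy' : (xt : Matrix (Fin 2) (Fin 2) ℝ) * yt = yt * xt :=
      Matrix.two_mul_comm_of_comm_of_not_scalar hns hx hy
    have hxy'' : xt * yt = yt * xt := by
      apply Subtype.ext
      simpa [Matrix.SpecialLinearGroup.coe_mul] using hxy'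
    apply Subtype.ext
    change (x : PSL2R) * y = y * x
    rw [← hxt, ← hyt, ← QuotientGroup.mk_mul, ← QuotientGroup.mk_mul, hxy'']

/-- The same inside the normaliser: **`C_{N(Γ̄)}(Γ̄) = 1` for `N(Γ̄) = N_{PGL₂(ℝ)}(Γ̄)`** (`Γ̄` embedded by
`toPGL`), `Γ̄ ≤ PSL₂(ℝ)` non-abelian acting freely on `ℍ` — the hypothesis shape of the finite-extension
slimness theorem for `N_{PGL₂(ℝ)}(Γ̄) ⊇ Γ̄` (RC column). [cite: MochizukiAbsTopIII2015, Proposition 4.2 (i) proof p.106] -/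
theorem pgl_centralizer_subgroupOf_normalizer_eq_bot (Γ : Subgroup PSL2R) [IsCancelSMul Γ ℍ]
    (hΓ : ∃ x y : Γ, x * y ≠ y * x) :
    Subgroup.centralizer
        (((Γ.map (Matrix.ProjectiveSpecialLinearGroup.toPGL (n := Fin 2) (R := ℝ))).subgroupOf
            (Subgroup.normalizer
              ((Γ.map (Matrix.ProjectiveSpecialLinearGroup.toPGL (n := Fin 2) (R := ℝ)) :
                Subgroup PGL(2, ℝ)) : Set PGL(2, ℝ))) :
          Set (Subgroup.normalizer
              ((Γ.map (Matrix.ProjectiveSpecialLinearGroup.toPGL (n := Fin 2) (R := ℝ)) :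
                Subgroup PGL(2, ℝ)) : Set PGL(2, ℝ))))) = ⊥ := by
  rw [Subgroup.eq_bot_iff_forall]
  intro z hz
  rw [Subgroup.mem_centralizer_iff] at hz
  have hz' : (z : PGL(2, ℝ)) ∈ Subgroup.centralizer
      ((Γ.map (Matrix.ProjectiveSpecialLinearGroup.toPGL (n := Fin 2) (R := ℝ)) :
        Subgroup PGL(2, ℝ)) : Set PGL(2, ℝ)) := by
    rw [Subgroup.mem_centralizer_iff]
    intro g hg
    have h := congrArg Subtype.val (hz ⟨g, Subgroup.le_normalizer hg⟩ (Subgroup.mem_subgroupOf.mpr hg))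
    simp only [Subgroup.coe_mul] at h
    exact h
  rw [pgl_centralizer_eq_bot Γ hΓ, Subgroup.mem_bot] at hz'
  exact Subtype.ext hz'

end HolRS

end Literature.AnabelianGeometry.AbsoluteAnabelian

end
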